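import Summits.RiemannHypothesis.RiemannHypothesis.Theses.WeilParity
import Literature.NumberTheory.LFunctions.WeilGroundEnergyParitySplit
import Literature.NumberTheory.LFunctions.WeilWindowSuzukiProofs
import Literature.NumberTheory.LFunctions.WeilGroundEnergyProofs
import HarnessLib

/-!
# `EvenWinsArch` (stmt-RiemannHypothesis-15433): negative lemmas of the refuter's crux attack

Crux of route WeilParity, rank 4 (RH-free, prime-free windows `0 < a ≤ (log 2)/2`):
`Summit.RiemannHypothesis.RiemannHypothesis.Theses.WeilParity.EvenWinsArch` — every odd
`L²`-normalised Weil test `o` on `[-a, a]` is matched, up to any `δ > 0`, by an even normalised one,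
`Re Q(e) ≤ Re Q(o) + δ` (`Q = weilQuadratic`).

Findings of the basic attacks (refuter-rattack-stmt-RiemannHypothesis-15433-0, 2026-08-17):

* NOT trivial, NOT a restatement of the summit: `simp / decide / norm_num / positivity / aesop /
  exact?` fail on the crux, on `EvenWinsArch → RiemannHypothesis` and on
  `RiemannHypothesis → EvenWinsArch` (scratch probes, rc 0 with `sorry` only).
* NOT vacuous: the odd unit sphere of every window `a > 0` is nonempty
  (`exists_isWeilTest_odd_sphere`), and `0 < (log 2)/2`.
* CONSEQUENCES OF THE CRUX, junk-free (this file, for later refuters: what a kill must produce):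
  `order_of_evenWinsArch` — the crux forces `ε_ev(a) ≤ ε_od(a)` (`weilEvenGroundEnergy ≤
  weilOddGroundEnergy`) on `(0, (log 2)/2]`, and `even_eq_ground_of_evenWinsArch` — it forces
  `ε_ev(a) = ε(a)` there (`ε = min ε_ev ε_od`, `weilGroundEnergy_eq_min_even_odd`). So ONE window
  `a ≤ (log 2)/2` with a certified odd Rayleigh quotient strictly below a certified LOWER bound of the
  even sector refutes the crux (`not_evenWinsArch_of_odd_lt_even`). Numerically no such window exists
  (five independent Rayleigh–Ritz tables on the item: `ε_od/ε_ev` grows from 1.48 at `a = 1/100` to 55 at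
  `(log 2)/2`; the converse directions are the line's `evenWinsAt_of_le`, prover territory).
* LOAD-BEARING HYPOTHESIS (kernel-checked): the normalisation `∫‖o‖² = 1` of the odd test —
  `evenWinsArch_false_without_norm` (witness `o = 0`, `Q(0) = 0`, against `ε(a) > 0` on small windows,
  `exists_weilGroundEnergy_pos`). The other deletions are harmless or trivialising and are recorded in
  the seat's Scratch.lean only: dropping `0 < a` adds only null windows (empty odd sphere,
  `weilWindowSphereValues_eq_empty`); dropping the evenness or the normalisation of the matching test
  `e` makes the clause trivial (`e = o`, resp. `e = 0`); dropping the ODDNESS of `o` is NOT a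
  strengthening but an equivalent form (`ε_ev = ε`).

Everything here is `sorry`-free; axioms `propext`, `Classical.choice`, `Quot.sound`.
-/

noncomputable section

open Literature.NumberTheory.LFunctions MeasureTheory Set
open Summit.RiemannHypothesis.RiemannHypothesis.Theses.WeilParity

namespace Summit.RiemannHypothesis.Cruxes.EvenWinsArch.Negative

/-- **The crux forces the order of the sector bottoms**: `EvenWinsArch` gives
`ε_ev(a) ≤ ε_od(a)` for every `0 < a ≤ (log 2)/2` (for each odd normalised `o` and each `δ > 0`,
`ε_ev(a) ≤ Re Q(e) ≤ Re Q(o) + δ`; then `le_csInf` over the nonempty odd sphere). [folklore] -/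
theorem order_of_evenWinsArch (h : EvenWinsArch) {a : ℝ} (ha : 0 < a) (hle : a ≤ Real.log 2 / 2) :
    weilEvenGroundEnergy a ≤ weilOddGroundEnergy a := by
  refine le_weilOddGroundEnergy_of_forall ha fun o ho hs hodd hn ↦ ?_
  refine le_of_forall_pos_lt_add fun δ hδ ↦ ?_
  obtain ⟨e, he, hes, hev, hen, hle'⟩ := h a ha hle o ho hs hodd hn (δ / 2) (by positivity)
  have := weilEvenGroundEnergy_le he hes hev hen
  linarith

/-- **The crux forces the even sector to attain the bottom**: `ε_ev(a) = ε(a)` on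
`(0, (log 2)/2]` (`ε = min ε_ev ε_od`, Suzuki 2026 (4.10), tree `weilGroundEnergy_eq_min_even_odd`).
[folklore] -/
theorem even_eq_ground_of_evenWinsArch (h : EvenWinsArch) {a : ℝ} (ha : 0 < a)
    (hle : a ≤ Real.log 2 / 2) : weilEvenGroundEnergy a = weilGroundEnergy a := by
  rw [weilGroundEnergy_eq_min_even_odd, min_eq_left (order_of_evenWinsArch h ha hle)]

/-- **KILL CRITERION.** One prime-free window `0 < a ≤ (log 2)/2` and ONE odd normalised window test
`o` whose energy lies strictly below a lower bound `L` of the whole even sector refute the crux.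
(What a certified refutation must produce: an odd Rayleigh quotient below a certified LOWER bound
of the even sector; numerically the margin has the opposite sign, `ε_od/ε_ev ≥ 1.48`.) [folklore] -/
theorem not_evenWinsArch_of_odd_lt_even {a L : ℝ} (ha : 0 < a) (hle : a ≤ Real.log 2 / 2)
    {o : ℝ → ℂ} (ho : IsWeilTest o) (hos : tsupport o ⊆ Icc (-a) a) (hodd : ∀ t, o (-t) = -o t)
    (hon : ∫ t, ‖o t‖ ^ 2 = (1 : ℝ)) (hoL : (weilQuadratic o).re < L)
    (hL : ∀ e : ℝ → ℂ, IsWeilTest e → tsupport e ⊆ Icc (-a) a → (∀ t, e (-t) = e t) →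
      ∫ t, ‖e t‖ ^ 2 = (1 : ℝ) → L ≤ (weilQuadratic e).re) :
    ¬ EvenWinsArch := fun h ↦ by
  have h1 : L ≤ weilEvenGroundEnergy a := le_weilEvenGroundEnergy_of_forall ha hL
  have h2 : weilOddGroundEnergy a ≤ (weilQuadratic o).re := weilOddGroundEnergy_le ho hos hodd hon
  linarith [order_of_evenWinsArch h ha hle]

/-- **Any proof must use the normalisation of the odd test**: with `∫‖o‖² = 1` deleted, `o = 0`
(odd, smooth, `tsupport 0 = ∅`, `Q(0) = 0`) is admissible at every window and the clause forces
`ε(a) ≤ ε_ev(a) ≤ δ` for all `δ > 0`, against the coercivity `ε(a) > 0` on small windows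
(Yoshida 1992 / Bombieri 2000 Thm. 12, tree `exists_weilGroundEnergy_pos`; witness window
`a = min a₁ (1/100) ≤ (log 2)/2`). [folklore] -/
theorem evenWinsArch_false_without_norm :
    ¬ ∀ a : ℝ, 0 < a → a ≤ Real.log 2 / 2 → ∀ o : ℝ → ℂ, IsWeilTest o →
      tsupport o ⊆ Set.Icc (-a) a → (∀ t, o (-t) = -o t) → ∀ δ : ℝ, 0 < δ →
      ∃ e : ℝ → ℂ, IsWeilTest e ∧ tsupport e ⊆ Set.Icc (-a) a ∧ (∀ t, e (-t) = e t) ∧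
      ∫ t, ‖e t‖ ^ 2 = (1 : ℝ) ∧ (weilQuadratic e).re ≤ (weilQuadratic o).re + δ := by
  intro h
  obtain ⟨a₁, ha₁, hpos⟩ := exists_weilGroundEnergy_pos
  set a := min a₁ (1 / 100) with ha_def
  have ha : 0 < a := lt_min ha₁ (by norm_num)
  have hale : a ≤ Real.log 2 / 2 := by
    have := Real.log_two_gt_d9
    exact (min_le_right _ _).trans (by linarith)
  have hεpos : 0 < weilGroundEnergy a := hpos a ha (min_le_left _ _)
  have ht : IsWeilTest (0 : ℝ → ℂ) := ⟨contDiff_const, HasCompactSupport.zero⟩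
  have hs : tsupport (0 : ℝ → ℂ) ⊆ Icc (-a) a := by
    rw [tsupport_eq_empty_iff.2 rfl]; exact empty_subset _
  obtain ⟨e, he, hes, hev, hen, hle⟩ :=
    h a ha hale 0 ht hs (fun t ↦ by simp) (weilGroundEnergy a / 2) (by positivity)
  rw [weilQuadratic_zero, Complex.zero_re, zero_add] at hle
  have h1 : weilGroundEnergy a ≤ (weilQuadratic e).re :=
    (weilGroundEnergy_le_weilEvenGroundEnergy a).trans (weilEvenGroundEnergy_le he hes hev hen)
  linarith

end Summit.RiemannHypothesis.Cruxes.EvenWinsArch.Negative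

end
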